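import Summits.FinalStateConjecture.FinalStateConjecture.Theses.HomotheticSurfaceGravity

set_option linter.dupNamespace false

/-!
# Birth skeleton of piece C `ProfileAtFirstNakedPoint` (child of crux `NakedTangentProfile`, stmt-FinalStateConjecture-17353)

Two stubs and the real composition `ProfileAtFirstNakedPoint_of`:
* `stub_selfSimilarExtraction` — SELF-SIMILAR EXTRACTION at a first naked point: exit ∨ SOME smooth self-similar
  vacuum profile (possibly FLAT: Minkowski minus its vertex) is a `C²` tangent profile there (scale-critical
  compactness modulo scaling and gauge, Rodnianski–Shlapentokh-Rothman GAFA 28 Thm 1.2 shape; regularity of the limit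
  across its cone).
* `stub_flatProfileExit` — FLAT TANGENT PROFILES EXIT: a first naked point at which a flat smooth self-similar profile
  is `C²`-tangent is either impossible (ε-regularity / breakdown criterion: a flat scale-critical limit with the
  centring condition means no Type-I concentration) or belongs to a datum that exits (Type-II concentration is
  infinitely fine-tuned).
Composition: case split on `Z.IsNonflat` for the extracted profile.
-/

namespace Summit.FinalStateConjecture.FinalStateConjecture.Cruxes.NakedTangentProfile.FirstNakedPointZorn.BirthC

open Set Filter Function
open scoped Manifold ContDiff Topology
open Literature.Geometry.Lorentzian
open Summit.FinalStateConjecture.FinalStateConjecture.Theses.HomotheticSurfaceGravity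

/-- **Stub C1 — self-similar extraction at a first naked point (flat limits allowed).** -/
theorem stub_selfSimilarExtraction :
    ∀ (X : Type) [TopologicalSpace X] [ChartedSpace Literature.Geometry.Lorentzian.E3 X] [IsManifold (𝓡 3) ((⊤ : ℕ∞) : WithTop ℕ∞) X] [T2Space X] [SecondCountableTopology X] [ConnectedSpace X], ∀ D ∈ Literature.Geometry.Lorentzian.admissibleVacuumData X, ∀ 𝒟 : Literature.Geometry.Lorentzian.VacuumCauchyDevelopment D, 𝒟.IsMaximal → ∀ P : Set 𝒟.carrier, 𝒟.toCauchyDevelopment.FirstNakedPoint P → (∃ (e : Literature.Geometry.Lorentzian.AFEnd X) (F : EuclideanSpace ℝ (Fin 1) → Literature.Geometry.Lorentzian.InitialDataSet (𝓡 3) X), Literature.Geometry.Lorentzian.InitialDataSet.IsTameDataFamily e 1 F ∧ Literature.Geometry.Lorentzian.InitialDataSet.IsImmersedAtZero 1 F ∧ F 0 = D ∧ Function.Injective F ∧ (∀ c, F c ∈ Literature.Geometry.Lorentzian.admissibleVacuumData X) ∧ ∃ ε : ℝ, 0 < ε ∧ ∀ c, c ≠ 0 → ‖c‖ < ε → ((∃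 𝒟' : Literature.Geometry.Lorentzian.VacuumCauchyDevelopment (F c), 𝒟'.IsMaximal) ∧ ∀ 𝒟' : Literature.Geometry.Lorentzian.VacuumCauchyDevelopment (F c), 𝒟'.IsMaximal → Summit.FinalStateConjecture.HasCompleteNullInfinity 𝒟'.toCauchyDevelopment ∧ ∃ (O : Set 𝒟'.carrier) (d : Literature.Geometry.Lorentzian.FinalStateDecomposition 𝒟'.toSpacetime O 2), (∀ i, Literature.Geometry.Lorentzian.Kerr.IsSubextremal (d.mass i) (d.spin i)) ∧ O = Summit.FinalStateConjecture.exteriorOf 𝒟'.toCauchyDevelopment d.charted ∧ Summit.FinalStateConjecture.RaysStayInClosure 𝒟'.toCauchyDevelopment O ∧ Summit.FinalStateConjecture.HasExhaustiveCharts d ∧ Summit.FinalStateConjecture.IsFutureOriented d)) ∨ ∃ Z : Literature.Geometry.Lorentzian.SelfSimilarVacuumProfile.{0} ((⊤ : ℕ∞) : WithTop ℕ∞), Literature.Geometry.Lorentzian.Spacetime.IsTangentProfileAt 𝒟.toSpacetime P Z.toSpacetime Z.past 2 := by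
  sorry

/-- **Stub C2 — flat tangent profiles at a first naked point force an exit.** -/
theorem stub_flatProfileExit :
    ∀ (X : Type) [TopologicalSpace X] [ChartedSpace Literature.Geometry.Lorentzian.E3 X] [IsManifold (𝓡 3) ((⊤ : ℕ∞) : WithTop ℕ∞) X] [T2Space X] [SecondCountableTopology X] [ConnectedSpace X], ∀ D ∈ Literature.Geometry.Lorentzian.admissibleVacuumData X, ∀ 𝒟 : Literature.Geometry.Lorentzian.VacuumCauchyDevelopment D, 𝒟.IsMaximal → ∀ P : Set 𝒟.carrier, 𝒟.toCauchyDevelopment.FirstNakedPoint P → ∀ Z : Literature.Geometry.Lorentzian.SelfSimilarVacuumProfile.{0} ((⊤ : ℕ∞) : WithTop ℕ∞), ¬ Z.IsNonflat → Literature.Geometry.Lorentzian.Spacetime.IsTangentProfileAt 𝒟.toSpacetime P Z.toSpacetime Z.past 2 → (∃ (e : Literature.Geometry.Lorentzian.AFEnd X) (F : EuclideanSpace ℝ (Fin 1) → Literature.Geometry.Lorentzian.InitialDataSet (𝓡 3) X), Literature.Geometry.Lorentzian.InitialDataSet.IsTameDataFamily e 1 F ∧ Literature.Geometry.Lorentzian.InitialDataSet.IsImmersedAtZero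 1 F ∧ F 0 = D ∧ Function.Injective F ∧ (∀ c, F c ∈ Literature.Geometry.Lorentzian.admissibleVacuumData X) ∧ ∃ ε : ℝ, 0 < ε ∧ ∀ c, c ≠ 0 → ‖c‖ < ε → ((∃ 𝒟' : Literature.Geometry.Lorentzian.VacuumCauchyDevelopment (F c), 𝒟'.IsMaximal) ∧ ∀ 𝒟' : Literature.Geometry.Lorentzian.VacuumCauchyDevelopment (F c), 𝒟'.IsMaximal → Summit.FinalStateConjecture.HasCompleteNullInfinity 𝒟'.toCauchyDevelopment ∧ ∃ (O : Set 𝒟'.carrier) (d : Literature.Geometry.Lorentzian.FinalStateDecomposition 𝒟'.toSpacetime O 2), (∀ i, Literature.Geometry.Lorentzian.Kerr.IsSubextremal (d.mass i) (d.spin i)) ∧ O = Summit.FinalStateConjecture.exteriorOf 𝒟'.toCauchyDevelopment d.charted ∧ Summit.FinalStateConjecture.RaysStayInClosure 𝒟'.toCauchyDevelopment O ∧ Summit.FinalStateConjecture.HasExhaustiveCharts d ∧ Summit.FinalStateConjecture.IsFutureOriented d)) := by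
  sorry

/-- **Piece C from its two stubs** (hypothesis form; no `sorry` here). -/
theorem profileAtFirstNakedPoint_of_stubs :
    (∀ (X : Type) [TopologicalSpace X] [ChartedSpace Literature.Geometry.Lorentzian.E3 X] [IsManifold (𝓡 3) ((⊤ : ℕ∞) : WithTop ℕ∞) X] [T2Space X] [SecondCountableTopology X] [ConnectedSpace X], ∀ D ∈ Literature.Geometry.Lorentzian.admissibleVacuumData X, ∀ 𝒟 : Literature.Geometry.Lorentzian.VacuumCauchyDevelopment D, 𝒟.IsMaximal → ∀ P : Set 𝒟.carrier, 𝒟.toCauchyDevelopment.FirstNakedPoint P → (∃ (e : Literature.Geometry.Lorentzian.AFEnd X) (F : EuclideanSpace ℝ (Fin 1) → Literature.Geometry.Lorentzian.InitialDataSet (𝓡 3) X), Literature.Geometry.Lorentzian.InitialDataSet.IsTameDataFamily e 1 F ∧ Literature.Geometry.Lorentzian.InitialDataSet.IsImmersedAtZero 1 F ∧ F 0 = D ∧ Function.Injective F ∧ (∀ c, F c ∈ Literature.Geometry.Lorentzian.admissibleVacuumData X) ∧ ∃ ε : ℝ, 0 < ε ∧ ∀ c, c ≠ 0 → ‖c‖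 < ε → ((∃ 𝒟' : Literature.Geometry.Lorentzian.VacuumCauchyDevelopment (F c), 𝒟'.IsMaximal) ∧ ∀ 𝒟' : Literature.Geometry.Lorentzian.VacuumCauchyDevelopment (F c), 𝒟'.IsMaximal → Summit.FinalStateConjecture.HasCompleteNullInfinity 𝒟'.toCauchyDevelopment ∧ ∃ (O : Set 𝒟'.carrier) (d : Literature.Geometry.Lorentzian.FinalStateDecomposition 𝒟'.toSpacetime O 2), (∀ i, Literature.Geometry.Lorentzian.Kerr.IsSubextremal (d.mass i) (d.spin i)) ∧ O = Summit.FinalStateConjecture.exteriorOf 𝒟'.toCauchyDevelopment d.charted ∧ Summit.FinalStateConjecture.RaysStayInClosure 𝒟'.toCauchyDevelopment O ∧ Summit.FinalStateConjecture.HasExhaustiveCharts d ∧ Summit.FinalStateConjecture.IsFutureOriented d)) ∨ ∃ Z : Literature.Geometry.Lorentzian.SelfSimilarVacuumProfile.{0} ((⊤ : ℕ∞) : WithTop ℕ∞), Literature.Geometry.Lorentzian.Spacetime.IsTangentProfileAt 𝒟.toSpacetime P Z.toSpacetime Z.past 2) →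
    (∀ (X : Type) [TopologicalSpace X] [ChartedSpace Literature.Geometry.Lorentzian.E3 X] [IsManifold (𝓡 3) ((⊤ : ℕ∞) : WithTop ℕ∞) X] [T2Space X] [SecondCountableTopology X] [ConnectedSpace X], ∀ D ∈ Literature.Geometry.Lorentzian.admissibleVacuumData X, ∀ 𝒟 : Literature.Geometry.Lorentzian.VacuumCauchyDevelopment D, 𝒟.IsMaximal → ∀ P : Set 𝒟.carrier, 𝒟.toCauchyDevelopment.FirstNakedPoint P → ∀ Z : Literature.Geometry.Lorentzian.SelfSimilarVacuumProfile.{0} ((⊤ : ℕ∞) : WithTop ℕ∞), ¬ Z.IsNonflat → Literature.Geometry.Lorentzian.Spacetime.IsTangentProfileAt 𝒟.toSpacetime P Z.toSpacetime Z.past 2 → (∃ (e : Literature.Geometry.Lorentzian.AFEnd X) (F : EuclideanSpace ℝ (Fin 1) → Literature.Geometry.Lorentzian.InitialDataSet (𝓡 3) X), Literature.Geometry.Lorentzian.InitialDataSet.IsTameDataFamily e 1 F ∧ Literature.Geometry.Lorentzian.InitialDataSet.IsImmersedAtZero 1 F ∧ F 0 = D ∧ Function.Injective F ∧ (∀ c,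 F c ∈ Literature.Geometry.Lorentzian.admissibleVacuumData X) ∧ ∃ ε : ℝ, 0 < ε ∧ ∀ c, c ≠ 0 → ‖c‖ < ε → ((∃ 𝒟' : Literature.Geometry.Lorentzian.VacuumCauchyDevelopment (F c), 𝒟'.IsMaximal) ∧ ∀ 𝒟' : Literature.Geometry.Lorentzian.VacuumCauchyDevelopment (F c), 𝒟'.IsMaximal → Summit.FinalStateConjecture.HasCompleteNullInfinity 𝒟'.toCauchyDevelopment ∧ ∃ (O : Set 𝒟'.carrier) (d : Literature.Geometry.Lorentzian.FinalStateDecomposition 𝒟'.toSpacetime O 2), (∀ i, Literature.Geometry.Lorentzian.Kerr.IsSubextremal (d.mass i) (d.spin i)) ∧ O = Summit.FinalStateConjecture.exteriorOf 𝒟'.toCauchyDevelopment d.charted ∧ Summit.FinalStateConjecture.RaysStayInClosure 𝒟'.toCauchyDevelopment O ∧ Summit.FinalStateConjecture.HasExhaustiveCharts d ∧ Summit.FinalStateConjecture.IsFutureOriented d))) →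
    (∀ (X : Type) [TopologicalSpace X] [ChartedSpace Literature.Geometry.Lorentzian.E3 X] [IsManifold (𝓡 3) ((⊤ : ℕ∞) : WithTop ℕ∞) X] [T2Space X] [SecondCountableTopology X] [ConnectedSpace X], ∀ D ∈ Literature.Geometry.Lorentzian.admissibleVacuumData X, ∀ 𝒟 : Literature.Geometry.Lorentzian.VacuumCauchyDevelopment D, 𝒟.IsMaximal → ∀ P : Set 𝒟.carrier, 𝒟.toCauchyDevelopment.FirstNakedPoint P → (∃ (e : Literature.Geometry.Lorentzian.AFEnd X) (F : EuclideanSpace ℝ (Fin 1) → Literature.Geometry.Lorentzian.InitialDataSet (𝓡 3) X), Literature.Geometry.Lorentzian.InitialDataSet.IsTameDataFamily e 1 F ∧ Literature.Geometry.Lorentzian.InitialDataSet.IsImmersedAtZero 1 F ∧ F 0 = D ∧ Function.Injective F ∧ (∀ c, F c ∈ Literature.Geometry.Lorentzian.admissibleVacuumData X) ∧ ∃ ε : ℝ, 0 < ε ∧ ∀ c, c ≠ 0 → ‖c‖ < ε → ((∃ 𝒟' : Literature.Geometry.Lorentzian.VacuumCauchyDevelopment (F c), 𝒟'.IsMaximal)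 ∧ ∀ 𝒟' : Literature.Geometry.Lorentzian.VacuumCauchyDevelopment (F c), 𝒟'.IsMaximal → Summit.FinalStateConjecture.HasCompleteNullInfinity 𝒟'.toCauchyDevelopment ∧ ∃ (O : Set 𝒟'.carrier) (d : Literature.Geometry.Lorentzian.FinalStateDecomposition 𝒟'.toSpacetime O 2), (∀ i, Literature.Geometry.Lorentzian.Kerr.IsSubextremal (d.mass i) (d.spin i)) ∧ O = Summit.FinalStateConjecture.exteriorOf 𝒟'.toCauchyDevelopment d.charted ∧ Summit.FinalStateConjecture.RaysStayInClosure 𝒟'.toCauchyDevelopment O ∧ Summit.FinalStateConjecture.HasExhaustiveCharts d ∧ Summit.FinalStateConjecture.IsFutureOriented d)) ∨ ∃ Z : Literature.Geometry.Lorentzian.SelfSimilarVacuumProfile.{0} ((⊤ : ℕ∞) : WithTop ℕ∞), Z.IsNonflat ∧ Literature.Geometry.Lorentzian.Spacetime.IsTangentProfileAt 𝒟.toSpacetime P Z.toSpacetime Z.past 2) := by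
  intro h1 h2 X _ _ _ _ _ _ D hD 𝒟 hmax P hP
  refine Classical.or_iff_not_imp_left.mpr fun hex ↦ ?_
  obtain ⟨Z, htan⟩ := (h1 X D hD 𝒟 hmax P hP).resolve_left hex
  by_cases hZ : Z.IsNonflat
  · exact ⟨Z, hZ, htan⟩
  · exact absurd (h2 X D hD 𝒟 hmax P hP Z hZ htan) hex

/-- **Piece C by name from the registered stubs** (`sorry` only inside `stub_*`). -/
theorem ProfileAtFirstNakedPoint_of :
    (∀ (X : Type) [TopologicalSpace X] [ChartedSpace Literature.Geometry.Lorentzian.E3 X] [IsManifold (𝓡 3) ((⊤ : ℕ∞) : WithTop ℕ∞) X] [T2Space X] [SecondCountableTopology X] [ConnectedSpace X], ∀ D ∈ Literature.Geometry.Lorentzian.admissibleVacuumData X, ∀ 𝒟 : Literature.Geometry.Lorentzian.VacuumCauchyDevelopment D, 𝒟.IsMaximal → ∀ P : Set 𝒟.carrier, 𝒟.toCauchyDevelopment.FirstNakedPoint P → (∃ (e : Literature.Geometry.Lorentzian.AFEnd X) (F : EuclideanSpace ℝ (Fin 1) → Literature.Geometry.Lorentzian.InitialDataSet (𝓡 3)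 X), Literature.Geometry.Lorentzian.InitialDataSet.IsTameDataFamily e 1 F ∧ Literature.Geometry.Lorentzian.InitialDataSet.IsImmersedAtZero 1 F ∧ F 0 = D ∧ Function.Injective F ∧ (∀ c, F c ∈ Literature.Geometry.Lorentzian.admissibleVacuumData X) ∧ ∃ ε : ℝ, 0 < ε ∧ ∀ c, c ≠ 0 → ‖c‖ < ε → ((∃ 𝒟' : Literature.Geometry.Lorentzian.VacuumCauchyDevelopment (F c), 𝒟'.IsMaximal) ∧ ∀ 𝒟' : Literature.Geometry.Lorentzian.VacuumCauchyDevelopment (F c), 𝒟'.IsMaximal → Summit.FinalStateConjecture.HasCompleteNullInfinity 𝒟'.toCauchyDevelopment ∧ ∃ (O : Set 𝒟'.carrier) (d : Literature.Geometry.Lorentzian.FinalStateDecomposition 𝒟'.toSpacetime O 2), (∀ i, Literature.Geometry.Lorentzian.Kerr.IsSubextremal (d.mass i) (d.spin i)) ∧ O = Summit.FinalStateConjecture.exteriorOf 𝒟'.toCauchyDevelopment d.charted ∧ Summit.FinalStateConjecture.RaysStayInClosure 𝒟'.toCauchyDevelopment O ∧ Summit.FinalStateConjecture.HasExhaustiveCharts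 d ∧ Summit.FinalStateConjecture.IsFutureOriented d)) ∨ ∃ Z : Literature.Geometry.Lorentzian.SelfSimilarVacuumProfile.{0} ((⊤ : ℕ∞) : WithTop ℕ∞), Z.IsNonflat ∧ Literature.Geometry.Lorentzian.Spacetime.IsTangentProfileAt 𝒟.toSpacetime P Z.toSpacetime Z.past 2) :=
  profileAtFirstNakedPoint_of_stubs stub_selfSimilarExtraction stub_flatProfileExit

end Summit.FinalStateConjecture.FinalStateConjecture.Cruxes.NakedTangentProfile.FirstNakedPointZorn.BirthC
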